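import Literature.MathematicalPhysics.QuantumFieldTheory.Dimock2011to13.DecouplingWeights

/-!
# Dimock, *The renormalization group according to Balaban* II (large fields), §3.7–§3.9: the EXTRACTION OF THE SMALL
# FACTOR `e^{−r_{k+1}}` from a difference of weakened Green's functions — «in the random walk expansion for the
# difference, any path must start in □, exit □^*, and then return to □. Thus the minimum number of steps is
# approximately 2[r_{k+1}] and this enables us to extract a factor e^{−r_{k+1}}» — PROVED on the operator-ring skeleton

**Citation header (reproduction of PUBLISHED work; template of the Bałaban lattice Yang–Mills cell).**
J. Dimock, *The renormalization group according to Balaban II. Large fields*, J. Math. Phys. **54** (2013) 092301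
(= arXiv:1212.5562v2) [Dimock2013BalabanII]: §3.7 `G^0_{k+1,Ω′}(□^*)` TeX L2995–3000, Lemma 3.6 `\label{stem}` proof
L3478–3487, Lemma 3.8 `\label{r6}` proof L3586–3591 (the same device; also §3.11 L3750–3765, L3985).  J. Dimock, *… I.
Small fields*, Rev. Math. Phys. **25** (2013) 1330010 (= arXiv:1108.1335v2) [Dimock2013], §2.5 (rws) L1106–1120 (the
weakened expansion `G_k(s) = Σ_ω s_ωG_{k,ω}`).  TeX line numbers refer to the arXiv sources held by the cell on this hub
(`run/shared/lean/archive/nearmiss/qft-balaban/dimock/src/1212.5562/1212.5562.tex`, 7217 lines, sha256[:16]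
75c5792fc48eacbc; `…/1108.1335/1108.1335.tex`).  Dimock's papers are published and refereed and are the cell's
TEMPLATE, not manuscripts under audit; no quantity of the Bałaban series is touched.

**What the paper prints (verbatim).**  L2995–3000: *"Next let □ be an LM cube in Ω_{k+1}, and let □^* be the same with
[r_{k+1}] layers of LM cubes added. We define G^0_{k+1,Ω′}(□^*) = G^0_{k+1,Ω′}(s_{□^*} = 1, s_{□^{*,c}} = 0) which has no
coupling outside of □^*."*  L3478–3487: *"The bound on δC^{1/2}_{k,Ω′} = C^{1/2}_{k,Ω′} − (C^{1/2}_{k,Ω′})^{loc} follows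
from a modification of lemma th2 which says for y, y′ ∈ □ ⊂ Ω_{k+1}  ‖1_{Δ_y}(G_{k,Ω′,r}(□^*) − G_{k,Ω′,r})1_{Δ_{y′}}f‖₂ ≤
Ce^{−r_{k+1}}e^{−γd_{Ω′}(y,y′)}‖f‖₂  This is true since in the random walk expansion for the difference, any path must
start in □, exit □^*, and then return to □. Thus the minimum number of steps is at approximately 2[r_{k+1}] and this
enables us to extract a factor e^{−r_{k+1}}."*  L3586–3591: *"This holds since in the random walk expansion for
1_{Δ_y}(G_{k,Ω′,r} − G_{k,r})1_{Δ_{y′}} any path must start in Ω^♮_{k+1}, pass through Ω^c_{k+1}, and then return to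
Ω^♮_{k+1}. But Ω^♮_{k+1} and Ω^c_{k+1} are separated by [r_{k+1}] LM-cubes … which allows us to extract a factor
e^{−r_{k+1}}."*

**What is reproduced here (kernel-checked, zero `sorry`; imports the sibling `DecouplingWeights` only).**  On the
operator-ring skeleton of `RandomWalkExpansion`∕`DecouplingWeights` (operators in a complete normed algebra `R` over a
normed field `𝕜`; blocks `z ∈ Z` with cubes `cubes z`; walks `ω : Fin n → Z` after a start `z₀`, `walkTerm` = `G_{k,ω}`,
`Xω` = `X_ω`, `sω` = `s_ω`, `level s n` = the `n`-step part of `G(s) = Gs`, `WalkSumBound c₀ q` = `Σ_{|ω|=n}‖G_{k,ω}‖ ≤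
c₀qⁿ`):
* §1 **`level_sub_level`**, **`level_sub_level_eq_sum_filter`**: if two weight assignments `s₁`, `s₀` AGREE on a set
  `U` of cubes, only walks with `X_ω ⊄ U` contribute to `G(s₁) − G(s₀)` (the expansion *"for the difference"*);
* §2 **`mul_level_sub_eq_zero`**: with a left localiser `P` (`P·h_z = 0` for `z ∉ S₀`; print `P = 1_{Δ_y}`) and the EXIT
  HYPOTHESIS at length `m` (every walk of `< m` steps from `S₀` whose cubes leave `U` has `G_{k,ω} = 0` — the skeleton's
  form of *"the minimum number of steps is approximately 2[r_{k+1}]"*), the levels `n < m` of `P(G(s₁) − G(s₀))` vanish;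
* §3 `norm_level_sub_le` (`≤ 2c₀qⁿ`), **`norm_mul_Gs_sub_Gs_le`**: **`‖P(G(s₁) − G(s₀))‖ ≤ ‖P‖·2c₀·q^m·(1 − q)⁻¹`**
  (`0 ≤ q < 1`, `|s_□| ≤ 1`), and the instance **`norm_mul_Gs_indicator_sub_le`** for `G(□^*) − G` (`s₁ = 1_U`, `s₀ ≡
  1`);
* §4 **`pow_le_exp_neg`**: `q ≤ e^{−1}`, `r ≤ m` ⟹ `q^m ≤ e^{−r}` (the extracted factor);
* §5 a non-vacuity `example`;
* §6 (v1.1) THE EXIT HYPOTHESIS DISCHARGED FROM THE JUNCTION GEOMETRY ([Dimock2013] §2.4 L932–938 *"such that ω_j,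
  ω_{j+1} are neighbors"*, L972 *"h_z h_{z′} = 0 unless z, z′ are neighbors"*): **`walkTail_eq_zero_of_junction`**∕
  **`walkTerm_eq_zero_of_junction`** (a walk term vanishes at ANY junction `h_{ω_j}K_{ω_{j+1}} = 0`, not only the first),
  **`rho_le_of_walkTerm_ne_zero`** (block pseudo-distance `ρ` with the triangle inequality, junction range `ℓ`: a
  non-vanishing walk satisfies `ρ(ω_0, ω_j) ≤ ℓ·j`), **`hexit_of_junction_range`** (`U ⊇` the cubes of every block
  within `ℓ(m − 1)` of `S₀` ⟹ `hexit` at length `m`), and **`norm_mul_Gs_sub_Gs_le_of_range`** (§3's extraction with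
  geometric hypotheses only);
* §7 (v1.2) THE RETURN HALF AND THE PRINTED COUNT `2[r_{k+1}]`: `lastBlock`, **`walkTerm_mul_eq_zero_of_last`** (a walk
  term ends with `h_{ω_n}`: a right localiser `P′` kills walks not ending in `S₀′`), **`rho_step_le_of_walkTerm_ne_zero`**
  (`ρ(ω_i, ω_{i+e}) ≤ ℓ·e` along a non-vanishing walk), **`hexit_two_sided`** (start in `S₀`, END in `S₀′`, cubes outside
  `U` ⟹ at least `2m` steps), **`mul_level_sub_mul_eq_zero`**, **`norm_mul_Gs_sub_Gs_mul_le`** and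
  **`norm_mul_Gs_sub_Gs_mul_le_of_range`**: **`‖P(G(s₁) − G(s₀))P′‖ ≤ ‖P‖·‖P′‖·2c₀·q^{2m}·(1 − q)⁻¹`**.

**Readings (declared).**  (i) The geometric content of "exit" — §2–§3 take it as the HYPOTHESIS `hexit`; §6 (v1.1) PROVES
`hexit` from the junction structure of the skeleton (a contributing walk is a chain of `ρ`-neighbours of range `ℓ`, so
fewer than `m` steps from `S₀` stay inside the `ℓ(m − 1)`-neighbourhood; print: blocks overlap, `U = □^*` = □ with
`[r_{k+1}]` layers of LM cubes); the identification of `ρ`, `ℓ`, `U` with the lattice objects of a given step is made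
at instantiation (on the torus carrier: `TorusCubeLayers.tdist`).  (ii) The print's `L²`∕kernel form with the extra
decay `e^{−γd(y,y′)}` is not reproduced — only the factor from the step count, in the norm of the skeleton.  (iii)
`2[r_{k+1}]` (exit AND return): §2–§6 use one localiser and any forced count `m`; §7 (v1.2) adds the right localiser
and proves the printed count `2m` (`m` out, `m` back) for a symmetric `ρ`.

**What is NOT claimed.**  Lemma 3.5 `th2`, (around), (steaming), the `L²` bounds, the weakened-expansion convergence
constants (`q = CM^{−1/2}`), the identification of `G(□^*)`, `(C^{1/2})^{loc}`, `Ψ(□^*)` with the model's objects; (salt),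
(skunky2), R^{(1)}–R^{(3)}, R^{(7)} as functions of the fields; anything of B1–B16.  NOT summit progress; NOT a statement
about any Bałaban paper; NOT continuum; NOT Clay.  Imports `Dimock2011to13.DecouplingWeights` only; no Summits import;
sub-namespace `…Dimock2011to13.WalkExitExtraction`; modifies nothing.  Unit `b2b-balaban-template` gen 34 (journal CLAIM
D2-EXIT-KERNEL); v1.1 gen 35 (journal CLAIM D2-EXIT-DISCHARGE: §6 added, §1–§5 unchanged); v1.2 gen 35 (journal CLAIM
D2-EXIT-RETURN: §7 added, §1–§6 unchanged); cell records TEMPLATE.md §4.2 rows «D2 §3.6–3.7», «D2 §3.8», GAPS C-tmpl34-8,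
C-tmpl35-1, C-tmpl35-8.
-/

noncomputable section

open Finset Filter Topology
open scoped BigOperators

namespace Literature.MathematicalPhysics.QuantumFieldTheory.Dimock2011to13.WalkExitExtraction

open RandomWalkExpansion (walkTerm walkTail)
open DecouplingWeights

/-! ## §1 The difference of two weakened expansions: walks inside the agreement set cancel -/

section Difference

variable {C : Type*} [DecidableEq C] {Z : Type*} [Fintype Z] {𝕜 : Type*} [NormedField 𝕜]
  {R : Type*} [NormedRing R] [NormedAlgebra 𝕜 R]
variable {A : R} {H G : Z → R} {cubes : Z → Finset C} {s₁ s₀ : C → 𝕜} {U : Finset C}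

omit [Fintype Z] [NormedField 𝕜] in
/-- Two weight assignments agreeing on `U` give the same `s_ω` to every walk with `X_ω ⊆ U`. [folklore] -/
private theorem sω_eq_of_subset {𝕜 : Type*} [CommMonoidWithZero 𝕜] {s₁ s₀ : C → 𝕜}
    (hs : ∀ b ∈ U, s₁ b = s₀ b) {n : ℕ} {ω : Fin n → Z} (hω : Xω cubes ω ⊆ U) :
    sω cubes s₁ ω = sω cubes s₀ ω := by
  unfold sω
  exact prod_congr rfl fun b hb => hs b (hω hb)

/-- The `n`-step part of `G(s₁) − G(s₀)` is `Σ_{ω_0}Σ_ω (s₁_ω − s₀_ω)G_{k,ω}`. [cite: Dimock2013, §2.5 eq. (rws) (arXiv:1108.1335v2 TeX L1106–1111)] -/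
theorem level_sub_level (s₁ s₀ : C → 𝕜) (n : ℕ) :
    level A H G cubes s₁ n - level A H G cubes s₀ n
      = ∑ z₀, ∑ ω : Fin n → Z, (sω cubes s₁ ω - sω cubes s₀ ω) • walkTerm A H G z₀ ω := by
  unfold level
  rw [← sum_sub_distrib]
  refine sum_congr rfl fun z₀ _ => ?_
  rw [← sum_sub_distrib]
  refine sum_congr rfl fun ω _ => ?_
  rw [sub_smul]

/-- **Walks inside the agreement set cancel**: if `s₁ = s₀` on `U`, only walks with `X_ω ⊄ U` contribute to
`G(s₁) − G(s₀)` — the random walk expansion *"for the difference"* consists of the paths that LEAVE `U` (print: `U = □^*`,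
`s₁ = (s_{□^*} = 1, s_{□^{*c}} = 0)`, `s₀ ≡ 1`: *"any path must start in □, exit □^*, and then return to □"*).
[cite: Dimock2013BalabanII, Lemma stem proof (arXiv:1212.5562v2 TeX L3478–3487); Lemma r6 proof L3586–3591] -/
theorem level_sub_level_eq_sum_filter (hs : ∀ b ∈ U, s₁ b = s₀ b) (n : ℕ) :
    level A H G cubes s₁ n - level A H G cubes s₀ n
      = ∑ z₀, ∑ ω ∈ univ.filter (fun ω : Fin n → Z => ¬ Xω cubes ω ⊆ U),
          (sω cubes s₁ ω - sω cubes s₀ ω) • walkTerm A H G z₀ ω := by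
  rw [level_sub_level]
  refine sum_congr rfl fun z₀ _ => ?_
  rw [sum_filter]
  refine sum_congr rfl fun ω _ => ?_
  by_cases h : Xω cubes ω ⊆ U
  · rw [if_neg (not_not_intro h), sω_eq_of_subset hs h, sub_self, zero_smul]
  · rw [if_pos h]

/-! ## §2 A left localiser and the exit hypothesis: the short levels vanish -/

variable {P : R} {S₀ : Finset Z} {m : ℕ}

omit [DecidableEq C] [Fintype Z] [NormedField 𝕜] [NormedAlgebra 𝕜 R] in
/-- `P·G_{k,ω} = 0` when the walk starts outside the support blocks of `P` (`P h_{ω_0} = 0`). [folklore] -/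
private theorem mul_walkTerm_eq_zero (hP : ∀ z₀, z₀ ∉ S₀ → P * H z₀ = 0) {z₀ : Z} (hz : z₀ ∉ S₀) {n : ℕ}
    (ω : Fin n → Z) : P * walkTerm A H G z₀ ω = 0 := by
  unfold walkTerm
  rw [← mul_assoc, ← mul_assoc, ← mul_assoc, hP z₀ hz]
  simp

/-- **THE SHORT LEVELS OF THE DIFFERENCE VANISH**: with a left localiser `P` supported on the blocks `S₀` (`P h_{z} = 0`
for `z ∉ S₀`; print: `P = 1_{Δ_y}`, `y ∈ □`) and the EXIT HYPOTHESIS — every walk of fewer than `m` steps starting in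
`S₀` whose cubes `X_ω` leave `U` has `G_{k,ω} = 0` (print: consecutive blocks of a contributing walk overlap, so a walk
from `□` needs `≈ [r_{k+1}]` steps to leave `□^*`; *"Thus the minimum number of steps is approximately 2[r_{k+1}]"*) —
the `n`-step part of `P(G(s₁) − G(s₀))` is `0` for `n < m`. [cite: Dimock2013BalabanII, Lemma stem proof (arXiv:1212.5562v2 TeX L3478–3487)] -/
theorem mul_level_sub_eq_zero (hP : ∀ z₀, z₀ ∉ S₀ → P * H z₀ = 0)
    (hexit : ∀ n, n < m → ∀ z₀ ∈ S₀, ∀ ω : Fin n → Z, ¬ Xω cubes ω ⊆ U → walkTerm A H G z₀ ω = 0)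
    (hs : ∀ b ∈ U, s₁ b = s₀ b) {n : ℕ} (hn : n < m) :
    P * (level A H G cubes s₁ n - level A H G cubes s₀ n) = 0 := by
  rw [level_sub_level_eq_sum_filter hs, mul_sum]
  refine sum_eq_zero fun z₀ _ => ?_
  rw [mul_sum]
  refine sum_eq_zero fun ω hω => ?_
  rw [mul_smul_comm]
  by_cases hz : z₀ ∈ S₀
  · rw [hexit n hn z₀ hz ω (mem_filter.1 hω).2, mul_zero, smul_zero]
  · rw [mul_walkTerm_eq_zero hP hz, smul_zero]

/-! ## §3 The extraction: `‖P(G(s₁) − G(s₀))‖ ≤ ‖P‖·2c₀·q^m/(1 − q)` -/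

/-- the crude per-level bound of the difference on `|s_□| ≤ 1`: `‖level(s₁) n − level(s₀) n‖ ≤ 2c₀qⁿ`. [cite: Dimock2013, §2.5 (arXiv:1108.1335v2 TeX L1106–1120)] -/
theorem norm_level_sub_le {c₀ q : ℝ} (hW : WalkSumBound A H G c₀ q) (hs₁ : ∀ b, ‖s₁ b‖ ≤ 1)
    (hs₀ : ∀ b, ‖s₀ b‖ ≤ 1) (n : ℕ) :
    ‖level A H G cubes s₁ n - level A H G cubes s₀ n‖ ≤ 2 * c₀ * q ^ n := by
  calc ‖level A H G cubes s₁ n - level A H G cubes s₀ n‖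
      ≤ ‖level A H G cubes s₁ n‖ + ‖level A H G cubes s₀ n‖ := norm_sub_le _ _
    _ ≤ c₀ * q ^ n + c₀ * q ^ n := add_le_add (norm_level_le_one hW hs₁ n) (norm_level_le_one hW hs₀ n)
    _ = 2 * c₀ * q ^ n := by ring

/-- **THE EXTRACTION OF THE SMALL FACTOR** — *"This is true since in the random walk expansion for the difference, any
path must start in □, exit □^*, and then return to □. Thus the minimum number of steps is at approximately 2[r_{k+1}]
and this enables us to extract a factor e^{−r_{k+1}}"*: under the walk-sum bound `Σ_{|ω|=n}‖G_{k,ω}‖ ≤ c₀qⁿ` (`0 ≤ q <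
1`), weights `|s_□| ≤ 1` agreeing on `U`, a left localiser `P` on the blocks `S₀` and the exit hypothesis at length `m`:
`‖P(G(s₁) − G(s₀))‖ ≤ ‖P‖·2c₀·q^m·(1 − q)⁻¹` — only the levels `n ≥ m` survive, each bounded by `2c₀qⁿ`.
[cite: Dimock2013BalabanII, Lemma stem proof (arXiv:1212.5562v2 TeX L3478–3487); Lemma r6 proof L3586–3591] -/
theorem norm_mul_Gs_sub_Gs_le [CompleteSpace R] {c₀ q : ℝ} (hW : WalkSumBound A H G c₀ q) (hq0 : 0 ≤ q)
    (hq : q < 1) (hs₁ : ∀ b, ‖s₁ b‖ ≤ 1) (hs₀ : ∀ b, ‖s₀ b‖ ≤ 1) (hs : ∀ b ∈ U, s₁ b = s₀ b)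
    (hP : ∀ z₀, z₀ ∉ S₀ → P * H z₀ = 0)
    (hexit : ∀ n, n < m → ∀ z₀ ∈ S₀, ∀ ω : Fin n → Z, ¬ Xω cubes ω ⊆ U → walkTerm A H G z₀ ω = 0) :
    ‖P * (Gs A H G cubes s₁ - Gs A H G cubes s₀)‖ ≤ ‖P‖ * (2 * c₀) * q ^ m * (1 - q)⁻¹ := by
  set f : ℕ → R := fun n => P * (level A H G cubes s₁ n - level A H G cubes s₀ n) with hf
  have h1 : Summable fun n => level A H G cubes s₁ n :=
    (summable_and_norm_Gs_le hq0 hq (norm_level_le_one (cubes := cubes) hW hs₁)).1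
  have h0 : Summable fun n => level A H G cubes s₀ n :=
    (summable_and_norm_Gs_le hq0 hq (norm_level_le_one (cubes := cubes) hW hs₀)).1
  have hfs : Summable f := ((h1.sub h0).mul_left P)
  have hGs : P * (Gs A H G cubes s₁ - Gs A H G cubes s₀) = ∑' n, f n := by
    unfold Gs
    rw [← h1.tsum_sub h0, ← (h1.sub h0).tsum_mul_left P]
  -- the levels below `m` vanish
  have hshift : ∑' n, f n = ∑' i, f (i + m) := by
    rw [← hfs.sum_add_tsum_nat_add m]
    rw [sum_eq_zero fun i hi => ?_, zero_add]
    exact mul_level_sub_eq_zero hP hexit hs (mem_range.1 hi)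
  -- the tail
  have hbound : ∀ i, ‖f (i + m)‖ ≤ ‖P‖ * (2 * c₀) * q ^ m * q ^ i := fun i => by
    calc ‖f (i + m)‖ ≤ ‖P‖ * ‖level A H G cubes s₁ (i + m) - level A H G cubes s₀ (i + m)‖ := norm_mul_le _ _
      _ ≤ ‖P‖ * (2 * c₀ * q ^ (i + m)) := mul_le_mul_of_nonneg_left (norm_level_sub_le hW hs₁ hs₀ _) (norm_nonneg _)
      _ = ‖P‖ * (2 * c₀) * q ^ m * q ^ i := by rw [pow_add]; ring
  have hg : Summable fun i => ‖P‖ * (2 * c₀) * q ^ m * q ^ i :=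
    (summable_geometric_of_lt_one hq0 hq).mul_left _
  rw [hGs, hshift]
  calc ‖∑' i, f (i + m)‖ ≤ ∑' i, ‖f (i + m)‖ := norm_tsum_le_tsum_norm (.of_nonneg_of_le (fun _ => norm_nonneg _) hbound hg)
    _ ≤ ∑' i, ‖P‖ * (2 * c₀) * q ^ m * q ^ i :=
        Summable.tsum_le_tsum hbound (.of_nonneg_of_le (fun _ => norm_nonneg _) hbound hg) hg
    _ = ‖P‖ * (2 * c₀) * q ^ m * (1 - q)⁻¹ := by rw [tsum_mul_left, tsum_geometric_of_lt_one hq0 hq]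

/-- **`G(□^*) − G`**: the case `s₁ = 1_U` (*"G(□^*) ≡ G(s_{□^*} = 1, s_{□^{*,c}} = 0) which has no coupling outside of
□^*"*) against `s₀ ≡ 1` (`G(1) = G`). [cite: Dimock2013BalabanII, §3.7 (arXiv:1212.5562v2 TeX L2995–3000); Lemma stem proof L3478–3487] -/
theorem norm_mul_Gs_indicator_sub_le [CompleteSpace R] {c₀ q : ℝ} (hW : WalkSumBound A H G c₀ q) (hq0 : 0 ≤ q)
    (hq : q < 1) (U : Finset C) (hP : ∀ z₀, z₀ ∉ S₀ → P * H z₀ = 0)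
    (hexit : ∀ n, n < m → ∀ z₀ ∈ S₀, ∀ ω : Fin n → Z, ¬ Xω cubes ω ⊆ U → walkTerm A H G z₀ ω = 0) :
    ‖P * (Gs A H G cubes (fun b => if b ∈ U then (1 : 𝕜) else 0) - Gs A H G cubes fun _ => (1 : 𝕜))‖
      ≤ ‖P‖ * (2 * c₀) * q ^ m * (1 - q)⁻¹ :=
  norm_mul_Gs_sub_Gs_le hW hq0 hq (fun b => by by_cases h : b ∈ U <;> simp [h]) (fun _ => by simp)
    (fun b hb => by simp [hb]) hP hexit

end Difference

/-! ## §4 The arithmetic of the small factor: `q^m ≤ e^{−r}` -/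

/-- With the one-step ratio `q ≤ e^{−1}` (print: `q = CM^{−1/2}`-type, `M` large) and at least `r` forced steps, the
extracted factor is `q^m ≤ e^{−r}` (*"extract a factor e^{−r_{k+1}}"*). [cite: Dimock2013BalabanII, Lemma stem proof (arXiv:1212.5562v2 TeX L3484–3487)] -/
theorem pow_le_exp_neg {q r : ℝ} {m : ℕ} (hq0 : 0 ≤ q) (hq : q ≤ Real.exp (-1)) (hm : r ≤ m) :
    q ^ m ≤ Real.exp (-r) := by
  calc q ^ m ≤ Real.exp (-1) ^ m := pow_le_pow_left₀ hq0 hq m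
    _ = Real.exp (-(m : ℝ)) := by rw [← Real.exp_nat_mul]; ring_nf
    _ ≤ Real.exp (-r) := Real.exp_le_exp.2 (by linarith)

/-! ## §5 Non-vacuity -/

/-- The hypotheses are consistent (a one-block skeleton with the zero partition of unity: every walk term vanishes,
`c₀ = 0`, `q = ½`, `m = 3`). -/
example : ‖(1 : ℝ) * (Gs (0 : ℝ) (fun _ : Fin 1 => (0 : ℝ)) (fun _ => 0) (fun _ => ({0} : Finset (Fin 1)))
      (fun b => if b ∈ ({0} : Finset (Fin 1)) then (1 : ℝ) else 0)
      - Gs (0 : ℝ) (fun _ : Fin 1 => (0 : ℝ)) (fun _ => 0) (fun _ => ({0} : Finset (Fin 1))) fun _ => (1 : ℝ))‖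
    ≤ ‖(1 : ℝ)‖ * (2 * 0) * (1 / 2 : ℝ) ^ 3 * (1 - 1 / 2)⁻¹ :=
  norm_mul_Gs_indicator_sub_le (S₀ := ∅) (m := 3) (fun n => by simp [RandomWalkExpansion.walkTerm]) (by norm_num)
    (by norm_num) {0} (fun z₀ _ => by simp) (fun _ _ z₀ hz => absurd hz (Finset.notMem_empty _))

/-! ## §6 (v1.1) Discharging the exit hypothesis from the junction geometry

The print's walks are sequences *"such that ω_j, ω_{j+1} are neighbors"* ([Dimock2013] TeX L932–938) because *"h_z h_{z′}
= 0 unless z, z′ are neighbors"* (L972): on the skeleton a walk term over an arbitrary sequence VANISHES at any junction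
`h_{ω_j}K_{ω_{j+1}} = 0` — not only at the first one (`RandomWalkExpansion.walkTerm_eq_zero_of_first_junction`).  With a
block pseudo-distance `ρ` (triangle inequality) and a junction range `ℓ` (`h_zK_{z′} = 0` once `ρ(z,z′) > ℓ`), a
NON-vanishing walk of `n` steps from `z₀` stays inside `ρ(z₀,·) ≤ ℓ·n`; so fewer than `m` steps from `S₀` cannot reach a
block whose cubes leave `U` when `U` contains the cubes of every block within `ℓ(m − 1)` of `S₀` — *"any path must start
in □, exit □^*, and then return to □. Thus the minimum number of steps is approximately 2[r_{k+1}]"*: the hypothesis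
`hexit` of §2–§3 is a THEOREM of the block geometry. -/

section Junctions

variable {Z : Type*} {R : Type*} [Ring R] {A : R} {H G : Z → R}

open RandomWalkExpansion (Kz walkTerm_eq_zero_of_first_junction)

/-- **A walk tail vanishes at ANY non-neighbour junction**: if `h_{ω_j}K_{ω_{j+1}} = 0` for some consecutive pair of
steps then `(K_{ω_1}G_k(□̃_{ω_1})h_{ω_1})⋯(K_{ω_n}G_k(□̃_{ω_n})h_{ω_n}) = 0` (*"h_z h_{z′} = 0 unless z, z′ are
neighbors"*, so only sequences *"such that ω_j, ω_{j+1} are neighbors"* contribute). [cite: Dimock2013, §2.4 (arXiv:1108.1335v2 TeX L932–938, L972)] -/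
theorem walkTail_eq_zero_of_junction {n : ℕ} (ω : Fin n → Z) {j : ℕ} (hj : j + 1 < n)
    (h : H (ω ⟨j, by omega⟩) * Kz A H (ω ⟨j + 1, hj⟩) = 0) : walkTail A H G ω = 0 := by
  unfold walkTail
  set g : Fin n → R := fun i => Kz A H (ω i) * G (ω i) * H (ω i) with hg
  have hlen : (List.ofFn g).length = n := List.length_ofFn
  have hsplit : List.ofFn g
      = (List.ofFn g).take j ++ (g ⟨j, by omega⟩ :: g ⟨j + 1, hj⟩ :: (List.ofFn g).drop (j + 2)) := by
    conv_lhs => rw [← List.take_append_drop j (List.ofFn g)]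
    rw [List.drop_eq_getElem_cons (by omega), List.getElem_ofFn,
      List.drop_eq_getElem_cons (by omega), List.getElem_ofFn]
  have hpair : ∀ X : R, g ⟨j, by omega⟩ * (g ⟨j + 1, hj⟩ * X) = 0 := fun X => by
    simp only [hg, mul_assoc]
    rw [← mul_assoc (H (ω ⟨j, by omega⟩)) (Kz A H (ω ⟨j + 1, hj⟩)), h, zero_mul, mul_zero, mul_zero]
  rw [hsplit, List.prod_append, List.prod_cons, List.prod_cons, hpair, mul_zero]

/-- hence **a walk term `G_{k,ω}` vanishes at any non-neighbour junction** `h_{ω_j}K_{ω_{j+1}} = 0`, `j ≥ 1` (the first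
junction `h_{ω_0}K_{ω_1}` is `RandomWalkExpansion.walkTerm_eq_zero_of_first_junction`). [cite: Dimock2013, §2.4 (arXiv:1108.1335v2 TeX L932–938, L972)] -/
theorem walkTerm_eq_zero_of_junction (z₀ : Z) {n : ℕ} (ω : Fin n → Z) {j : ℕ} (hj : j + 1 < n)
    (h : H (ω ⟨j, by omega⟩) * Kz A H (ω ⟨j + 1, hj⟩) = 0) : walkTerm A H G z₀ ω = 0 := by
  unfold walkTerm
  rw [walkTail_eq_zero_of_junction ω hj h, mul_zero]

variable {ρ : Z → Z → ℕ} {ℓ : ℕ}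

/-- **A contributing walk is a chain of neighbours, so it does not go far**: with a block pseudo-distance `ρ`
(triangle inequality) and the junction range `ℓ` (`h_zK_{z′} = 0` whenever `ρ(z,z′) > ℓ` — *"h_z h_{z′} = 0 unless z, z′
are neighbors"*), a walk `(ω_0, ω_1, …, ω_n)` with `G_{k,ω} ≠ 0` has `ρ(ω_0, ω_j) ≤ ℓ·j` for every step. [cite: Dimock2013, §2.4 (arXiv:1108.1335v2 TeX L932–938, L972); Dimock2013BalabanII, Lemma stem proof (arXiv:1212.5562v2 TeX L3484–3486)] -/
theorem rho_le_of_walkTerm_ne_zero (htri : ∀ a b c, ρ a c ≤ ρ a b + ρ b c)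
    (hjunc : ∀ z z', ℓ < ρ z z' → H z * Kz A H z' = 0) (z₀ : Z) {n : ℕ} (ω : Fin n → Z)
    (hne : walkTerm A H G z₀ ω ≠ 0) : ∀ (j : ℕ) (hj : j < n), ρ z₀ (ω ⟨j, hj⟩) ≤ ℓ * (j + 1) := by
  intro j
  induction j with
  | zero =>
    intro hj
    obtain ⟨n', rfl⟩ : ∃ n', n = n' + 1 := ⟨n - 1, by omega⟩
    by_contra hlt
    have h0 : ℓ < ρ z₀ (ω 0) := by rw [show (0 : Fin (n' + 1)) = ⟨0, hj⟩ from rfl]; omega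
    exact hne (walkTerm_eq_zero_of_first_junction A H G z₀ ω (hjunc _ _ h0))
  | succ j ih =>
    intro hj
    have hprev := ih (by omega)
    by_contra hlt
    have hstep : ℓ < ρ (ω ⟨j, by omega⟩) (ω ⟨j + 1, hj⟩) := by
      by_contra hle
      have h3 := htri z₀ (ω ⟨j, by omega⟩) (ω ⟨j + 1, hj⟩)
      have e : ℓ * (j + 1 + 1) = ℓ * (j + 1) + ℓ := by ring
      omega
    exact hne (walkTerm_eq_zero_of_junction z₀ ω hj (hjunc _ _ hstep))

variable {C : Type*} [DecidableEq C] {cubes : Z → Finset C} {U : Finset C} {S₀ : Finset Z} {m : ℕ}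

/-- **THE EXIT HYPOTHESIS DISCHARGED** — *"any path must start in □, exit □^*, and then return to □. Thus the minimum
number of steps is approximately 2[r_{k+1}]"*: if `U` contains the cubes of every block within `ρ`-distance `ℓ(m − 1)`
of the start blocks `S₀` (print: `U = □^*` = □ with `[r_{k+1}]` layers added, blocks overlapping `Δ_y`, `y ∈ □`), then
every walk of fewer than `m` steps from `S₀` whose cubes `X_ω` leave `U` has `G_{k,ω} = 0` — the hypothesis `hexit` of
`mul_level_sub_eq_zero`∕`norm_mul_Gs_sub_Gs_le`. [cite: Dimock2013BalabanII, Lemma stem proof (arXiv:1212.5562v2 TeX L3478–3487); Lemma r6 proof L3586–3591; Dimock2013, §2.4 (arXiv:1108.1335v2 TeX L932–938, L972)] -/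
theorem hexit_of_junction_range (htri : ∀ a b c, ρ a c ≤ ρ a b + ρ b c)
    (hjunc : ∀ z z', ℓ < ρ z z' → H z * Kz A H z' = 0)
    (hU : ∀ z₀ ∈ S₀, ∀ z, ρ z₀ z ≤ ℓ * (m - 1) → cubes z ⊆ U) :
    ∀ n, n < m → ∀ z₀ ∈ S₀, ∀ ω : Fin n → Z, ¬ Xω cubes ω ⊆ U → walkTerm A H G z₀ ω = 0 := by
  intro n hn z₀ hz₀ ω hX
  by_contra hne
  refine hX fun b hb => ?_
  obtain ⟨⟨j, hj⟩, hjb⟩ := mem_Xω.1 hb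
  refine hU z₀ hz₀ _ ?_ hjb
  calc ρ z₀ (ω ⟨j, hj⟩) ≤ ℓ * (j + 1) := rho_le_of_walkTerm_ne_zero htri hjunc z₀ ω hne j hj
    _ ≤ ℓ * (m - 1) := Nat.mul_le_mul_left _ (by omega)

end Junctions

section ExitDischarged

variable {C : Type*} [DecidableEq C] {Z : Type*} [Fintype Z] {𝕜 : Type*} [NormedField 𝕜]
  {R : Type*} [NormedRing R] [NormedAlgebra 𝕜 R]
variable {A : R} {H G : Z → R} {cubes : Z → Finset C} {s₁ s₀ : C → 𝕜} {U : Finset C}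
variable {P : R} {S₀ : Finset Z} {m : ℕ} {ρ : Z → Z → ℕ} {ℓ : ℕ}

open RandomWalkExpansion (Kz)

/-- **THE EXTRACTION WITH GEOMETRIC HYPOTHESES ONLY**: `norm_mul_Gs_sub_Gs_le` with `hexit` supplied by
`hexit_of_junction_range` — walk-sum bound `Σ_{|ω|=n}‖G_{k,ω}‖ ≤ c₀qⁿ` (`0 ≤ q < 1`), weights `|s_□| ≤ 1` agreeing on
`U`, left localiser `P` on `S₀`, junction range `ℓ` for the block pseudo-distance `ρ`, and `U ⊇` the cubes of the
`ℓ(m − 1)`-neighbourhood of `S₀`: **`‖P(G(s₁) − G(s₀))‖ ≤ ‖P‖·2c₀·q^m·(1 − q)⁻¹`**. [cite: Dimock2013BalabanII, Lemma stem proof (arXiv:1212.5562v2 TeX L3478–3487); Lemma r6 proof L3586–3591] -/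
theorem norm_mul_Gs_sub_Gs_le_of_range [CompleteSpace R] {c₀ q : ℝ} (hW : WalkSumBound A H G c₀ q) (hq0 : 0 ≤ q)
    (hq : q < 1) (hs₁ : ∀ b, ‖s₁ b‖ ≤ 1) (hs₀ : ∀ b, ‖s₀ b‖ ≤ 1) (hs : ∀ b ∈ U, s₁ b = s₀ b)
    (hP : ∀ z₀, z₀ ∉ S₀ → P * H z₀ = 0) (htri : ∀ a b c, ρ a c ≤ ρ a b + ρ b c)
    (hjunc : ∀ z z', ℓ < ρ z z' → H z * Kz A H z' = 0)
    (hU : ∀ z₀ ∈ S₀, ∀ z, ρ z₀ z ≤ ℓ * (m - 1) → cubes z ⊆ U) :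
    ‖P * (Gs A H G cubes s₁ - Gs A H G cubes s₀)‖ ≤ ‖P‖ * (2 * c₀) * q ^ m * (1 - q)⁻¹ :=
  norm_mul_Gs_sub_Gs_le hW hq0 hq hs₁ hs₀ hs hP (hexit_of_junction_range htri hjunc hU)

/-- Non-vacuity of the geometric hypotheses (one block at distance `0` from itself, range `ℓ = 0`, `m = 3`). -/
example : ‖(1 : ℝ) * (Gs (0 : ℝ) (fun _ : Fin 1 => (0 : ℝ)) (fun _ => 0) (fun _ => ({0} : Finset (Fin 1)))
      (fun b => if b ∈ ({0} : Finset (Fin 1)) then (1 : ℝ) else 0)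
      - Gs (0 : ℝ) (fun _ : Fin 1 => (0 : ℝ)) (fun _ => 0) (fun _ => ({0} : Finset (Fin 1))) fun _ => (1 : ℝ))‖
    ≤ ‖(1 : ℝ)‖ * (2 * 0) * (1 / 2 : ℝ) ^ 3 * (1 - 1 / 2)⁻¹ :=
  norm_mul_Gs_sub_Gs_le_of_range (U := {0}) (S₀ := {0}) (m := 3) (ρ := fun _ _ => 0) (ℓ := 0)
    (fun n => by simp [RandomWalkExpansion.walkTerm]) (by norm_num) (by norm_num)
    (fun b => by by_cases h : b ∈ ({0} : Finset (Fin 1)) <;> simp [h]) (fun _ => by simp)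
    (fun b hb => by rw [if_pos hb])
    (fun z₀ hz => absurd (Finset.mem_singleton.2 (Subsingleton.elim z₀ 0)) hz) (fun _ _ _ => by simp)
    (fun _ _ h => absurd h (lt_irrefl 0)) (fun _ _ _ _ => Finset.Subset.refl _)

end ExitDischarged

/-! ## §7 (v1.2) The return half: a right localiser and the full count `2m` — «start in □, exit □^*, and then
return to □. Thus the minimum number of steps is approximately 2[r_{k+1}]»

With a localiser on BOTH sides (print: `1_{Δ_y}(G(□^*) − G)1_{Δ_{y′}}`, `y, y′ ∈ □`) a contributing walk must start in
`S₀`, reach a block whose cubes leave `U`, and END in `S₀′`; the chain bound of §6 in both directions forces `≥ m` steps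
out and `≥ m` steps back, so the levels `n < 2m` vanish and the extracted factor is `q^{2m}`. -/

section Return

variable {Z : Type*} {R : Type*} [Ring R] {A : R} {H G : Z → R}

open RandomWalkExpansion (Kz)

/-- the LAST block `ω_n` of a walk `(ω_0, ω_1, …, ω_n)` (`= ω_0` for the one-point walk). [cite: Dimock2013, §2.4 (arXiv:1108.1335v2 TeX L932–938)] -/
def lastBlock (z₀ : Z) {n : ℕ} (ω : Fin n → Z) : Z := if h : 0 < n then ω ⟨n - 1, by omega⟩ else z₀

/-- **A walk term ends with the factor `h_{ω_n}`**: `G_{k,ω}·P′ = 0` whenever `h_{ω_n}P′ = 0` (print: the right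
localiser `1_{Δ_{y′}}`). [cite: Dimock2013, §2.4 eq. (brand) (arXiv:1108.1335v2 TeX L1003–1013); Dimock2013BalabanII, Lemma stem proof (arXiv:1212.5562v2 TeX L3478–3487)] -/
theorem walkTerm_mul_eq_zero_of_last (z₀ : Z) {n : ℕ} (ω : Fin n → Z) {P' : R}
    (h : H (lastBlock z₀ ω) * P' = 0) : walkTerm A H G z₀ ω * P' = 0 := by
  unfold lastBlock at h
  unfold walkTerm walkTail
  cases n with
  | zero =>
    simp only [lt_irrefl, dif_neg, not_false_eq_true] at h
    rw [List.ofFn_zero, List.prod_nil, mul_one, mul_assoc (H z₀ * G z₀), h, mul_zero]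
  | succ k =>
    simp only [Nat.succ_pos', dif_pos] at h
    have hlast : (⟨k + 1 - 1, by omega⟩ : Fin (k + 1)) = Fin.last k := by
      ext; simp
    rw [hlast] at h
    rw [List.ofFn_succ', List.prod_concat]
    simp only [mul_assoc]
    rw [h]
    simp

variable {ρ : Z → Z → ℕ} {ℓ : ℕ}

/-- **The chain bound between any two blocks of a contributing walk**: `G_{k,ω} ≠ 0` ⟹ `ρ(ω_i, ω_{i+e}) ≤ ℓ·e` (each
junction is a pair of `ρ`-neighbours of range `ℓ`; `ρ(x,x) = 0`, triangle inequality). [cite: Dimock2013, §2.4 (arXiv:1108.1335v2 TeX L932–938, L972); Dimock2013BalabanII, Lemma r6 proof (arXiv:1212.5562v2 TeX L3586–3591)] -/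
theorem rho_step_le_of_walkTerm_ne_zero (hd0 : ∀ a, ρ a a = 0) (htri : ∀ a b c, ρ a c ≤ ρ a b + ρ b c)
    (hjunc : ∀ z z', ℓ < ρ z z' → H z * Kz A H z' = 0) (z₀ : Z) {n : ℕ} (ω : Fin n → Z)
    (hne : walkTerm A H G z₀ ω ≠ 0) :
    ∀ (e i : ℕ) (hi : i < n) (hie : i + e < n), ρ (ω ⟨i, hi⟩) (ω ⟨i + e, hie⟩) ≤ ℓ * e := by
  intro e
  induction e with
  | zero => intro i hi hie; simp [hd0]
  | succ e ih =>
    intro i hi hie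
    have hprev := ih i hi (by omega)
    by_contra hlt
    have hstep : ℓ < ρ (ω ⟨i + e, by omega⟩) (ω ⟨i + e + 1, by omega⟩) := by
      by_contra hle
      have h3 := htri (ω ⟨i, hi⟩) (ω ⟨i + e, by omega⟩) (ω ⟨i + e + 1, by omega⟩)
      have e1 : ℓ * (e + 1) = ℓ * e + ℓ := by ring
      have e2 : (⟨i + (e + 1), hie⟩ : Fin n) = ⟨i + e + 1, by omega⟩ := by ext; simp [Nat.add_assoc]
      rw [e2] at hlt
      omega
    exact hne (walkTerm_eq_zero_of_junction z₀ ω (j := i + e) (by omega) (hjunc _ _ hstep))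

variable {C : Type*} [DecidableEq C] {cubes : Z → Finset C} {U : Finset C} {S₀ S₀' : Finset Z} {m : ℕ}

/-- **EXIT AND RETURN NEED `2m` STEPS** — *"any path must start in □, exit □^*, and then return to □. Thus the minimum
number of steps is approximately 2[r_{k+1}]"*: with a symmetric block pseudo-distance, junction range `ℓ`, and `U`
containing the cubes of every block within `ℓ(m − 1)` of `S₀` and of `S₀′`, a walk of fewer than `2m` steps that starts
in `S₀`, ENDS in `S₀′` and has cubes outside `U` has `G_{k,ω} = 0`. [cite: Dimock2013BalabanII, Lemma stem proof (arXiv:1212.5562v2 TeX L3484–3486); Lemma r6 proof L3588–3590] -/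
theorem hexit_two_sided (hd0 : ∀ a, ρ a a = 0) (hsymm : ∀ a b, ρ a b = ρ b a)
    (htri : ∀ a b c, ρ a c ≤ ρ a b + ρ b c) (hjunc : ∀ z z', ℓ < ρ z z' → H z * Kz A H z' = 0)
    (hU : ∀ z₀ ∈ S₀, ∀ z, ρ z₀ z ≤ ℓ * (m - 1) → cubes z ⊆ U)
    (hU' : ∀ z₁ ∈ S₀', ∀ z, ρ z₁ z ≤ ℓ * (m - 1) → cubes z ⊆ U) :
    ∀ n, n < 2 * m → ∀ z₀ ∈ S₀, ∀ ω : Fin n → Z, lastBlock z₀ ω ∈ S₀' →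
      ¬ Xω cubes ω ⊆ U → walkTerm A H G z₀ ω = 0 := by
  intro n hn z₀ hz₀ ω hlast hX
  by_contra hne
  -- a block of the walk whose cubes leave `U`
  obtain ⟨b, hbX, hbU⟩ := Finset.not_subset.1 hX
  obtain ⟨⟨j, hj⟩, hjb⟩ := mem_Xω.1 hbX
  -- it is far from the start …
  have hfar₀ : ℓ * (m - 1) < ρ z₀ (ω ⟨j, hj⟩) := by
    by_contra hle
    exact hbU (hU z₀ hz₀ _ (not_lt.1 hle) hjb)
  have hout : ρ z₀ (ω ⟨j, hj⟩) ≤ ℓ * (j + 1) := rho_le_of_walkTerm_ne_zero htri hjunc z₀ ω hne j hj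
  -- … and far from the end
  have hn0 : 0 < n := by omega
  have hlast' : lastBlock z₀ ω = ω ⟨n - 1, by omega⟩ := by unfold lastBlock; rw [dif_pos hn0]
  have hfar₁ : ℓ * (m - 1) < ρ (ω ⟨n - 1, by omega⟩) (ω ⟨j, hj⟩) := by
    by_contra hle
    exact hbU (hU' _ (hlast' ▸ hlast) _ (not_lt.1 hle) hjb)
  have hback : ρ (ω ⟨j, hj⟩) (ω ⟨j + (n - 1 - j), by omega⟩) ≤ ℓ * (n - 1 - j) :=
    rho_step_le_of_walkTerm_ne_zero hd0 htri hjunc z₀ ω hne (n - 1 - j) j hj (by omega)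
  have e3 : (⟨j + (n - 1 - j), by omega⟩ : Fin n) = ⟨n - 1, by omega⟩ := by ext; simp; omega
  rw [e3, hsymm] at hback
  -- `m ≤ j + 1` and `m ≤ n − 1 − j`, so `2m ≤ n`
  have h1 : m - 1 < j + 1 := lt_of_mul_lt_mul_left (hfar₀.trans_le hout) (Nat.zero_le ℓ)
  have h2 : m - 1 < n - 1 - j := lt_of_mul_lt_mul_left (hfar₁.trans_le hback) (Nat.zero_le ℓ)
  omega

end Return

section ReturnNormed

variable {C : Type*} [DecidableEq C] {Z : Type*} [Fintype Z] {𝕜 : Type*} [NormedField 𝕜]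
  {R : Type*} [NormedRing R] [NormedAlgebra 𝕜 R]
variable {A : R} {H G : Z → R} {cubes : Z → Finset C} {s₁ s₀ : C → 𝕜} {U : Finset C}
variable {P P' : R} {S₀ S₀' : Finset Z} {M : ℕ}

open RandomWalkExpansion (Kz)

omit [Fintype Z] [NormedField 𝕜] [NormedAlgebra 𝕜 R] in
/-- `P·G_{k,ω} = 0` when the walk starts outside the support blocks of `P`. [folklore] -/
private theorem mul_walkTerm_eq_zero' (hP : ∀ z₀, z₀ ∉ S₀ → P * H z₀ = 0) {z₀ : Z} (hz : z₀ ∉ S₀) {n : ℕ}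
    (ω : Fin n → Z) : P * walkTerm A H G z₀ ω = 0 := by
  unfold walkTerm
  rw [← mul_assoc, ← mul_assoc, ← mul_assoc, hP z₀ hz]
  simp

/-- **THE LEVELS `n < M` OF `P(G(s₁) − G(s₀))P′` VANISH** under the two-sided exit hypothesis at length `M` (print:
`M = 2[r_{k+1}]`): left localiser `P` on `S₀` (`P h_z = 0` off `S₀`), right localiser `P′` on `S₀′` (`h_z P′ = 0` off
`S₀′`), weights agreeing on `U`. [cite: Dimock2013BalabanII, Lemma stem proof (arXiv:1212.5562v2 TeX L3478–3487); Lemma r6 proof L3586–3591] -/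
theorem mul_level_sub_mul_eq_zero (hP : ∀ z₀, z₀ ∉ S₀ → P * H z₀ = 0) (hP' : ∀ z, z ∉ S₀' → H z * P' = 0)
    (hexit2 : ∀ n, n < M → ∀ z₀ ∈ S₀, ∀ ω : Fin n → Z, lastBlock z₀ ω ∈ S₀' →
      ¬ Xω cubes ω ⊆ U → walkTerm A H G z₀ ω = 0)
    (hs : ∀ b ∈ U, s₁ b = s₀ b) {n : ℕ} (hn : n < M) :
    P * (level A H G cubes s₁ n - level A H G cubes s₀ n) * P' = 0 := by
  rw [level_sub_level_eq_sum_filter hs, mul_sum, sum_mul]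
  refine sum_eq_zero fun z₀ _ => ?_
  rw [mul_sum, sum_mul]
  refine sum_eq_zero fun ω hω => ?_
  rw [mul_smul_comm, smul_mul_assoc]
  by_cases hz : z₀ ∈ S₀
  · by_cases hl : lastBlock z₀ ω ∈ S₀'
    · rw [hexit2 n hn z₀ hz ω hl (mem_filter.1 hω).2, mul_zero, zero_mul, smul_zero]
    · rw [mul_assoc, walkTerm_mul_eq_zero_of_last z₀ ω (hP' _ hl), mul_zero, smul_zero]
  · rw [mul_walkTerm_eq_zero' hP hz, zero_mul, smul_zero]

/-- **THE TWO-SIDED EXTRACTION**: `‖P(G(s₁) − G(s₀))P′‖ ≤ ‖P‖·‖P′‖·2c₀·q^M·(1 − q)⁻¹` — only the levels `n ≥ M` survive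
(print: `M = 2[r_{k+1}]`, *"extract a factor e^{−r_{k+1}}"* from `q^{2[r_{k+1}]}`). [cite: Dimock2013BalabanII, Lemma stem proof (arXiv:1212.5562v2 TeX L3478–3487); Lemma r6 proof L3586–3591] -/
theorem norm_mul_Gs_sub_Gs_mul_le [CompleteSpace R] {c₀ q : ℝ} (hW : WalkSumBound A H G c₀ q) (hq0 : 0 ≤ q)
    (hq : q < 1) (hs₁ : ∀ b, ‖s₁ b‖ ≤ 1) (hs₀ : ∀ b, ‖s₀ b‖ ≤ 1) (hs : ∀ b ∈ U, s₁ b = s₀ b)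
    (hP : ∀ z₀, z₀ ∉ S₀ → P * H z₀ = 0) (hP' : ∀ z, z ∉ S₀' → H z * P' = 0)
    (hexit2 : ∀ n, n < M → ∀ z₀ ∈ S₀, ∀ ω : Fin n → Z, lastBlock z₀ ω ∈ S₀' →
      ¬ Xω cubes ω ⊆ U → walkTerm A H G z₀ ω = 0) :
    ‖P * (Gs A H G cubes s₁ - Gs A H G cubes s₀) * P'‖ ≤ ‖P‖ * ‖P'‖ * (2 * c₀) * q ^ M * (1 - q)⁻¹ := by
  set f : ℕ → R := fun n => P * (level A H G cubes s₁ n - level A H G cubes s₀ n) * P' with hf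
  have h1 : Summable fun n => level A H G cubes s₁ n :=
    (summable_and_norm_Gs_le hq0 hq (norm_level_le_one (cubes := cubes) hW hs₁)).1
  have h0 : Summable fun n => level A H G cubes s₀ n :=
    (summable_and_norm_Gs_le hq0 hq (norm_level_le_one (cubes := cubes) hW hs₀)).1
  have hfs : Summable f := ((h1.sub h0).mul_left P).mul_right P'
  have hGs : P * (Gs A H G cubes s₁ - Gs A H G cubes s₀) * P' = ∑' n, f n := by
    unfold Gs
    rw [← h1.tsum_sub h0, ← (h1.sub h0).tsum_mul_left P, ← ((h1.sub h0).mul_left P).tsum_mul_right P']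
  have hshift : ∑' n, f n = ∑' i, f (i + M) := by
    rw [← hfs.sum_add_tsum_nat_add M]
    rw [sum_eq_zero fun i hi => ?_, zero_add]
    exact mul_level_sub_mul_eq_zero hP hP' hexit2 hs (mem_range.1 hi)
  have hbound : ∀ i, ‖f (i + M)‖ ≤ ‖P‖ * ‖P'‖ * (2 * c₀) * q ^ M * q ^ i := fun i => by
    calc ‖f (i + M)‖ ≤ ‖P * (level A H G cubes s₁ (i + M) - level A H G cubes s₀ (i + M))‖ * ‖P'‖ :=
          norm_mul_le _ _
      _ ≤ ‖P‖ * ‖level A H G cubes s₁ (i + M) - level A H G cubes s₀ (i + M)‖ * ‖P'‖ :=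
          mul_le_mul_of_nonneg_right (norm_mul_le _ _) (norm_nonneg _)
      _ ≤ ‖P‖ * (2 * c₀ * q ^ (i + M)) * ‖P'‖ :=
          mul_le_mul_of_nonneg_right (mul_le_mul_of_nonneg_left (norm_level_sub_le hW hs₁ hs₀ _) (norm_nonneg _))
            (norm_nonneg _)
      _ = ‖P‖ * ‖P'‖ * (2 * c₀) * q ^ M * q ^ i := by rw [pow_add]; ring
  have hg : Summable fun i => ‖P‖ * ‖P'‖ * (2 * c₀) * q ^ M * q ^ i :=
    (summable_geometric_of_lt_one hq0 hq).mul_left _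
  rw [hGs, hshift]
  calc ‖∑' i, f (i + M)‖ ≤ ∑' i, ‖f (i + M)‖ := norm_tsum_le_tsum_norm (.of_nonneg_of_le (fun _ => norm_nonneg _) hbound hg)
    _ ≤ ∑' i, ‖P‖ * ‖P'‖ * (2 * c₀) * q ^ M * q ^ i :=
        Summable.tsum_le_tsum hbound (.of_nonneg_of_le (fun _ => norm_nonneg _) hbound hg) hg
    _ = ‖P‖ * ‖P'‖ * (2 * c₀) * q ^ M * (1 - q)⁻¹ := by rw [tsum_mul_left, tsum_geometric_of_lt_one hq0 hq]

variable {ρ : Z → Z → ℕ} {ℓ m : ℕ}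

/-- **THE TWO-SIDED EXTRACTION WITH GEOMETRIC HYPOTHESES ONLY, AT THE PRINTED COUNT `2m`**:
`‖P(G(s₁) − G(s₀))P′‖ ≤ ‖P‖·‖P′‖·2c₀·q^{2m}·(1 − q)⁻¹` (*"the minimum number of steps is approximately 2[r_{k+1}] and this
enables us to extract a factor e^{−r_{k+1}}"*). [cite: Dimock2013BalabanII, Lemma stem proof (arXiv:1212.5562v2 TeX L3478–3487); Lemma r6 proof L3586–3591] -/
theorem norm_mul_Gs_sub_Gs_mul_le_of_range [CompleteSpace R] {c₀ q : ℝ} (hW : WalkSumBound A H G c₀ q)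
    (hq0 : 0 ≤ q) (hq : q < 1) (hs₁ : ∀ b, ‖s₁ b‖ ≤ 1) (hs₀ : ∀ b, ‖s₀ b‖ ≤ 1) (hs : ∀ b ∈ U, s₁ b = s₀ b)
    (hP : ∀ z₀, z₀ ∉ S₀ → P * H z₀ = 0) (hP' : ∀ z, z ∉ S₀' → H z * P' = 0) (hd0 : ∀ a, ρ a a = 0)
    (hsymm : ∀ a b, ρ a b = ρ b a) (htri : ∀ a b c, ρ a c ≤ ρ a b + ρ b c)
    (hjunc : ∀ z z', ℓ < ρ z z' → H z * Kz A H z' = 0)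
    (hU : ∀ z₀ ∈ S₀, ∀ z, ρ z₀ z ≤ ℓ * (m - 1) → cubes z ⊆ U)
    (hU' : ∀ z₁ ∈ S₀', ∀ z, ρ z₁ z ≤ ℓ * (m - 1) → cubes z ⊆ U) :
    ‖P * (Gs A H G cubes s₁ - Gs A H G cubes s₀) * P'‖
      ≤ ‖P‖ * ‖P'‖ * (2 * c₀) * q ^ (2 * m) * (1 - q)⁻¹ :=
  norm_mul_Gs_sub_Gs_mul_le hW hq0 hq hs₁ hs₀ hs hP hP' (hexit_two_sided hd0 hsymm htri hjunc hU hU')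

end ReturnNormed

end Literature.MathematicalPhysics.QuantumFieldTheory.Dimock2011to13.WalkExitExtraction

end
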